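import Summits.ABC.IUTFork.Joshi.TestGenuinePinsVacuityDegreeCut
import Literature.NumberTheory.NumberFields.MinkowskiQuarticSexticBounds
import HarnessLib

/-!
# Branch E TEST — the two residual degrees of the genuine-carrier pins: quartic `|d_F| ∈ {48, 144}`, sextic `|d_F| = 1728` (row Y-26)

Proof-only sequel (abc-iut cell, D-0079 R-J «Joshi Y-discharge census», row Y-26 / cell R-32; seat abc-iut-E-t32, gen 11; 0 definitions,
no `Prop` fact, FACT rows used: none) of this seat's `Joshi/TestGenuinePinsVacuityDegreeCut.lean` (p494605: pins at `settingPrVolSharp` ⇒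
`|d_F| = 4^{#A}·3^{#B}`, `2·#A, 2·#B ≤ [F:ℚ]`) and `Literature/NumberTheory/NumberFields/MinkowskiQuarticSexticBounds.lean` (Minkowski in
degrees `4`, `6`: `|d| ≥ 44`, `≥ 71` unless totally complex; `> 980`, `> 2360` if `r₂ ≤ 1`).  In the two degrees the Minkowski cut
(R-23a) does not reach, the pins still PIN THE DISCRIMINANT:

* **`natAbs_discr_eq_48_or_144_of_pinnedRegions_settingPrVolSharp`** — `[F:ℚ] = 4` ∧ pins ⇒ `|d_F| = 48 ∨ |d_F| = 144`, with EXACTLY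
  two ramified places over `2` (`card_ramifiedTwo_eq_two_…`: `2𝒪_F = 𝔭₁²𝔭₂²`, both `ℚ₂(√3)`-shaped), and `|d_F| = 48 ⇒ F` totally complex;
* **`natAbs_discr_eq_1728_of_pinnedRegions_settingPrVolSharp`** — `[F:ℚ] = 6` ∧ pins ⇒ `|d_F| = 1728 = 12³`, three ramified places over
  `2` and three over `3` (`card_ramifiedTwo/Three_eq_three_…`), and `2 ≤ r₂` (`two_le_nrComplexPlaces_…`).

CONSEQUENCE FOR THE RECORD (tree currency, no side taken): with the degree cut (R-23a + R-23b + p461949: pins ⇒ `[F:ℚ] ∈ {1, 4, 6}`) the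
located residual of row Y-26 is `F = ℚ` (INHABITED) ∪ {quartic `F`, no quadratic subfield, `d_F = ±48` totally complex or `|d_F| = 144`,
`2 = 𝔭₁²𝔭₂²` with `ℚ₂(√3)`-shaped completions} ∪ {sextic `F`, `|d_F| = 1728`, `r₂ ≥ 2`}; the emptiness of these two cells (minimal
discriminants: quartic `117 / 275 / 725` by signature, `|d| = 144` totally complex only `ℚ(ζ₁₂)`; sextic `≥ 9747`, Pohst 1982) is a PAPER
statement NOT claimed here.  HONEST SCOPE: OUR interface's pins at OUR sharp real container under Dupuy–Hilado's typed (Ind2); print's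
(xi-e)/(xi-f) untouched; locates / conditionally verifies; no abc claim. [claim: Mochizuki2012, status: disputed]
[cite: DupuyHilado2025, §4.9] [cite: NeukirchANT1999, Ch. III (2.9), (2.11), (2.14)] [cite: EsmondeMurty1999, Ex. 6.5.21 p. 93]
-/

noncomputable section

open Set Function NumberField IsDedekindDomain Metric
open scoped Pointwise Classical

namespace Summit.ABC.IUTFork.Joshi

open Thm311 Thm311.Real Cor312 Cor312Vol Literature.IUT.LogThetaLattice Literature.IUT.LogVolume
  Literature.IUT.HodgeTheaters Literature.NumberTheory.NumberFields
open Literature.NumberTheory.GaloisRepresentations.Ultrametric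
open GenuinePinsResidual GenuinePinsDividingLine

/-- The arithmetic of the quartic cell: `a, b ≤ 2`, `44 ≤ 4^a·3^b ⇒ (a, b) = (2, 1)` or `(2, 2)`. [folklore] -/
private theorem quartic_cell_arith {a b : ℕ} (ha : a ≤ 2) (hb : b ≤ 2) (h : 44 ≤ 4 ^ a * 3 ^ b) :
    a = 2 ∧ (4 ^ a * 3 ^ b = 48 ∨ 4 ^ a * 3 ^ b = 144) := by
  interval_cases a <;> interval_cases b <;> simp_all

/-- The arithmetic of the sextic cell: `a, b ≤ 3`, `980 < 4^a·3^b ⇒ a = b = 3` (`4³·3³ = 1728`). [folklore] -/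
private theorem sextic_cell_arith {a b : ℕ} (ha : a ≤ 3) (hb : b ≤ 3) (h : 980 < 4 ^ a * 3 ^ b) : a = 3 ∧ b = 3 := by
  interval_cases a <;> interval_cases b <;> simp_all

/-! ## 3. At `settingPrVolSharp`: positive information from the pins -/

variable {F : Type} [Field F] [NumberField F] (X : PilotData F)
  (M : Type) [Field M] [NumberField M]
  (archPk : ∀ (j : (thetaIndex X).Label) (vQ : (thetaIndex X).VQ), Set ((logShellsDH X (analyticLogv F)).Packet j vQ))
  (archSub : ∀ (j : (thetaIndex X).Label) (v : (thetaIndex X).V),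
    Set ((logShellsDH X (analyticLogv F)).Packet j ((thetaIndex X).over v)))
  (Ψ : ℤ → ∀ v : (thetaIndex X).V, v ∈ (thetaIndex X).Vbad → Set ((logShellsDH X (analyticLogv F)).StarPacket v))
  (act : ℤ → ∀ v : (thetaIndex X).V, v ∈ (thetaIndex X).Vbad →
    (logShellsDH X (analyticLogv F)).StarPacket v → Module.End ℚ ((logShellsDH X (analyticLogv F)).StarPacket v))
  (Mmod : ℤ → ∀ j : (thetaIndex X).LabelStar, Set ((logShellsDH X (analyticLogv F)).GlobalPacket j.1))
  (region : ℤ → ∀ j : (thetaIndex X).LabelStar, FinDivisor M → ∀ vQ : (thetaIndex X).VQ,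
    Set ((logShellsDH X (analyticLogv F)).Packet j.1 vQ))
  (frobAdm : ℤ → ℤ → ∀ (j : (thetaIndex X).Label) (vQ : (thetaIndex X).VQ),
    Set ((logShellsDH X (analyticLogv F)).Packet j vQ) → Prop)
  (frobLogvol : ℤ → ℤ → ∀ (j : (thetaIndex X).Label) (vQ : (thetaIndex X).VQ),
    Set ((logShellsDH X (analyticLogv F)).Packet j vQ) → ℝ)
  (frobΨ : ℤ → ℤ → ∀ v : (thetaIndex X).V, v ∈ (thetaIndex X).Vbad → Set ((logShellsDH X (analyticLogv F)).StarPacket v))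
  (frobMmod : ℤ → ℤ → ∀ j : (thetaIndex X).LabelStar, Set ((logShellsDH X (analyticLogv F)).GlobalPacket j.1))
  (unitImage : ℤ → ℤ → ℕ → ∀ (j : (thetaIndex X).Label) (vQ : (thetaIndex X).VQ),
    Set ((logShellsDH X (analyticLogv F)).Packet j vQ))
  (ballImage : ℤ → ℤ → ∀ (j : (thetaIndex X).Label) (vQ : (thetaIndex X).VQ),
    Set ((logShellsDH X (analyticLogv F)).Packet j vQ))
  (thetaDiv : ℤ → ℤ → LgpDivisor M (thetaIndex X).lstar)
  (n : ℤ) {HT : Type} {LogLink : HT → HT → Type} {IsFull : ∀ {s t : HT}, LogLink s t → Prop}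
  (lat : LGPGaussianLogThetaLattice LogLink IsFull)
  {Frd : Type} {IsoF : Frd → Frd → Type} {Ob : Frd → Type} {realify : Frd → Frd} {Strip : Type}
  {IsoS : Strip → Strip → Type} {Mv : ∀ v : (thetaIndex X).V, v ∈ (thetaIndex X).Vbad → Type}
  [∀ v h, Monoid (Mv v h)]
  (sig : GlobalLGPFrobenioidSignature (thetaIndex X).lstar (thetaIndex X).V (· ∈ (thetaIndex X).Vbad)
    Frd IsoF Ob realify Strip IsoS Mv)
  (split : SplittingMonoids Mv) {ObΔ : Type} {N : ∀ v : (thetaIndex X).V, v ∈ (thetaIndex X).Vbad → Type}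
  [∀ v h, Monoid (N v h)] (qData : QPilotData ObΔ N)
  (t : ∀ (pp : Nat.Primes) (_ : Fin X.lstar) (x : (thetaIndex X).Fibre (.inr pp)),
    haveI : Fact (pp : ℕ).Prime := ⟨pp.2⟩; kOf X pp.1 x)
  (tq : ∀ (pp : Nat.Primes) (x : (thetaIndex X).Fibre (.inr pp)), haveI : Fact (pp : ℕ).Prime := ⟨pp.2⟩; kOf X pp.1 x)
  (ρ : (∀ v : (thetaIndex X).V, v ∈ (thetaIndex X).Vbad → Set ((logShellsDH X (analyticLogv F)).StarPacket v)) →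
    ∀ (j : (thetaIndex X).Label) (vQ : (thetaIndex X).VQ), Set ((logShellsDH X (analyticLogv F)).Packet j vQ))
  (qK : ∀ v : (thetaIndex X).V, v ∈ (thetaIndex X).Vbad → Set ((logShellsDH X (analyticLogv F)).StarPacket v))
  (htq0 : ∀ pp x, tq pp x ≠ 0)
  (htq1 : ∀ (pp : Nat.Primes) (x : (thetaIndex X).Fibre (.inr pp)),
    haveI : Fact (pp : ℕ).Prime := ⟨pp.2⟩; placeOf X pp.1 x ∉ X.S → ‖tq pp x‖ = 1)


/-! ## 1. The quartic cell -/

/-- **`[F:ℚ] = 4` ∧ pins at `settingPrVolSharp` ⇒ exactly two ramified places over `2` and `|d_F| ∈ {48, 144}`, with `F` totally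
complex when `|d_F| = 48`.** [cite: NeukirchANT1999, Ch. III (2.9), (2.14)] [claim: Mochizuki2012, status: disputed] -/
theorem card_ramifiedTwo_eq_two_and_natAbs_discr_of_pinnedRegions_settingPrVolSharp
    (hpin : Cor312Vol.PinnedRegions
      (LatticeSituation.ofShells (logShellsDH X (analyticLogv F)) M archPk archSub
        (summandPiecesPr X (logvAnalytic_analyticLogv (F := F))).Adm
        (summandPiecesPr X (logvAnalytic_analyticLogv (F := F))).logvol Ψ act Mmod region frobAdm frobLogvol frobΨ frobMmod
        unitImage ballImage thetaDiv)
      (settingPrVolSharp X (logvAnalytic_analyticLogv (F := F)) M archPk archSub Ψ act Mmod region n lat sig split qData tq t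
        htq0 htq1) ρ qK)
    (h4 : Module.finrank ℚ F = 4) :
    ((placesOver F 2).filter fun v => v.asIdeal.ramificationIdx ℤ = 2).card = 2 ∧
      (((NumberField.discr F).natAbs = 48 ∧ NumberField.InfinitePlace.nrComplexPlaces F = 2) ∨
        (NumberField.discr F).natAbs = 144) := by
  have hd := natAbs_discr_eq_of_pinnedRegions_settingPrVolSharp X M archPk archSub Ψ act Mmod region frobAdm frobLogvol frobΨ
      frobMmod unitImage ballImage thetaDiv n lat sig split qData t tq ρ qK htq0 htq1 hpin
  have hA := two_mul_card_ramifiedTwo_le_of_pinnedRegions_settingPrVolSharp X M archPk archSub Ψ act Mmod region frobAdm frobLogvol frobΨ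
      frobMmod unitImage ballImage thetaDiv n lat sig split qData t tq ρ qK htq0 htq1 hpin
  have hB := two_mul_card_ramifiedThree_le_of_pinnedRegions_settingPrVolSharp X M archPk archSub Ψ act Mmod region frobAdm frobLogvol frobΨ
      frobMmod unitImage ballImage thetaDiv n lat sig split qData t tq ρ qK htq0 htq1 hpin
  rw [h4] at hA hB
  have h44 := fortyfour_le_abs_discr_of_finrank_eq_four F h4
  rw [Int.abs_eq_natAbs, hd] at h44
  have h44' : 44 ≤ 4 ^ ((placesOver F 2).filter fun v => v.asIdeal.ramificationIdx ℤ = 2).card *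
      3 ^ ((placesOver F 3).filter fun v => v.asIdeal.ramificationIdx ℤ = 2).card := by exact_mod_cast h44
  obtain ⟨ha, hval⟩ := quartic_cell_arith (by omega) (by omega) h44'
  refine ⟨ha, ?_⟩
  rw [hd]
  rcases hval with h48 | h144
  · refine Or.inl ⟨h48, nrComplexPlaces_eq_two_of_finrank_eq_four_of_abs_discr_le F h4 ?_⟩
    rw [Int.abs_eq_natAbs, hd, h48]; norm_num
  · exact Or.inr h144

/-- **The quartic cell: `[F:ℚ] = 4` ∧ pins ⇒ `|d_F| = 48 ∨ |d_F| = 144`.** [cite: NeukirchANT1999, Ch. III (2.9), (2.14)]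
[claim: Mochizuki2012, status: disputed] -/
theorem natAbs_discr_eq_48_or_144_of_pinnedRegions_settingPrVolSharp
    (hpin : Cor312Vol.PinnedRegions
      (LatticeSituation.ofShells (logShellsDH X (analyticLogv F)) M archPk archSub
        (summandPiecesPr X (logvAnalytic_analyticLogv (F := F))).Adm
        (summandPiecesPr X (logvAnalytic_analyticLogv (F := F))).logvol Ψ act Mmod region frobAdm frobLogvol frobΨ frobMmod
        unitImage ballImage thetaDiv)
      (settingPrVolSharp X (logvAnalytic_analyticLogv (F := F)) M archPk archSub Ψ act Mmod region n lat sig split qData tq t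
        htq0 htq1) ρ qK)
    (h4 : Module.finrank ℚ F = 4) : (NumberField.discr F).natAbs = 48 ∨ (NumberField.discr F).natAbs = 144 := by
  rcases (card_ramifiedTwo_eq_two_and_natAbs_discr_of_pinnedRegions_settingPrVolSharp X M archPk archSub Ψ act Mmod region frobAdm frobLogvol frobΨ
      frobMmod unitImage ballImage thetaDiv n lat sig split qData t tq ρ qK htq0 htq1 hpin h4).2 with ⟨h, -⟩ | h
  · exact Or.inl h
  · exact Or.inr h

/-! ## 2. The sextic cell -/

/-- **`[F:ℚ] = 6` ∧ pins at `settingPrVolSharp` ⇒ three ramified places over `2`, three over `3`, and `|d_F| = 1728`.**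
[cite: NeukirchANT1999, Ch. III (2.9), (2.14)] [claim: Mochizuki2012, status: disputed] -/
theorem card_ramified_eq_three_and_natAbs_discr_of_pinnedRegions_settingPrVolSharp
    (hpin : Cor312Vol.PinnedRegions
      (LatticeSituation.ofShells (logShellsDH X (analyticLogv F)) M archPk archSub
        (summandPiecesPr X (logvAnalytic_analyticLogv (F := F))).Adm
        (summandPiecesPr X (logvAnalytic_analyticLogv (F := F))).logvol Ψ act Mmod region frobAdm frobLogvol frobΨ frobMmod
        unitImage ballImage thetaDiv)
      (settingPrVolSharp X (logvAnalytic_analyticLogv (F := F)) M archPk archSub Ψ act Mmod region n lat sig split qData tq t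
        htq0 htq1) ρ qK)
    (h6 : Module.finrank ℚ F = 6) :
    ((placesOver F 2).filter fun v => v.asIdeal.ramificationIdx ℤ = 2).card = 3 ∧
      ((placesOver F 3).filter fun v => v.asIdeal.ramificationIdx ℤ = 2).card = 3 ∧ (NumberField.discr F).natAbs = 1728 := by
  have hd := natAbs_discr_eq_of_pinnedRegions_settingPrVolSharp X M archPk archSub Ψ act Mmod region frobAdm frobLogvol frobΨ
      frobMmod unitImage ballImage thetaDiv n lat sig split qData t tq ρ qK htq0 htq1 hpin
  have hA := two_mul_card_ramifiedTwo_le_of_pinnedRegions_settingPrVolSharp X M archPk archSub Ψ act Mmod region frobAdm frobLogvol frobΨ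
      frobMmod unitImage ballImage thetaDiv n lat sig split qData t tq ρ qK htq0 htq1 hpin
  have hB := two_mul_card_ramifiedThree_le_of_pinnedRegions_settingPrVolSharp X M archPk archSub Ψ act Mmod region frobAdm frobLogvol frobΨ
      frobMmod unitImage ballImage thetaDiv n lat sig split qData t tq ρ qK htq0 htq1 hpin
  rw [h6] at hA hB
  have h980 := lt_abs_discr_of_finrank_eq_six F h6
  rw [Int.abs_eq_natAbs, hd] at h980
  have h980' : 980 < 4 ^ ((placesOver F 2).filter fun v => v.asIdeal.ramificationIdx ℤ = 2).card *
      3 ^ ((placesOver F 3).filter fun v => v.asIdeal.ramificationIdx ℤ = 2).card := by exact_mod_cast h980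
  obtain ⟨ha, hb⟩ := sextic_cell_arith (by omega) (by omega) h980'
  refine ⟨ha, hb, ?_⟩
  rw [hd, ha, hb]; norm_num

/-- **The sextic cell: `[F:ℚ] = 6` ∧ pins ⇒ `|d_F| = 1728 = 12³`.** [cite: NeukirchANT1999, Ch. III (2.9), (2.14)]
[claim: Mochizuki2012, status: disputed] -/
theorem natAbs_discr_eq_1728_of_pinnedRegions_settingPrVolSharp
    (hpin : Cor312Vol.PinnedRegions
      (LatticeSituation.ofShells (logShellsDH X (analyticLogv F)) M archPk archSub
        (summandPiecesPr X (logvAnalytic_analyticLogv (F := F))).Adm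
        (summandPiecesPr X (logvAnalytic_analyticLogv (F := F))).logvol Ψ act Mmod region frobAdm frobLogvol frobΨ frobMmod
        unitImage ballImage thetaDiv)
      (settingPrVolSharp X (logvAnalytic_analyticLogv (F := F)) M archPk archSub Ψ act Mmod region n lat sig split qData tq t
        htq0 htq1) ρ qK)
    (h6 : Module.finrank ℚ F = 6) : (NumberField.discr F).natAbs = 1728 :=
  (card_ramified_eq_three_and_natAbs_discr_of_pinnedRegions_settingPrVolSharp X M archPk archSub Ψ act Mmod region frobAdm frobLogvol frobΨ
      frobMmod unitImage ballImage thetaDiv n lat sig split qData t tq ρ qK htq0 htq1 hpin h6).2.2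

/-- **… with at least two complex places** (`r₂ ≤ 1` would give `|d| > 2360`). [cite: NeukirchANT1999, Ch. III (2.14)]
[claim: Mochizuki2012, status: disputed] -/
theorem two_le_nrComplexPlaces_of_pinnedRegions_settingPrVolSharp_of_finrank_eq_six
    (hpin : Cor312Vol.PinnedRegions
      (LatticeSituation.ofShells (logShellsDH X (analyticLogv F)) M archPk archSub
        (summandPiecesPr X (logvAnalytic_analyticLogv (F := F))).Adm
        (summandPiecesPr X (logvAnalytic_analyticLogv (F := F))).logvol Ψ act Mmod region frobAdm frobLogvol frobΨ frobMmod
        unitImage ballImage thetaDiv)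
      (settingPrVolSharp X (logvAnalytic_analyticLogv (F := F)) M archPk archSub Ψ act Mmod region n lat sig split qData tq t
        htq0 htq1) ρ qK)
    (h6 : Module.finrank ℚ F = 6) : 2 ≤ NumberField.InfinitePlace.nrComplexPlaces F := by
  refine two_le_nrComplexPlaces_of_finrank_eq_six_of_abs_discr_le F h6 ?_
  rw [Int.abs_eq_natAbs, natAbs_discr_eq_1728_of_pinnedRegions_settingPrVolSharp X M archPk archSub Ψ act Mmod region frobAdm frobLogvol frobΨ
      frobMmod unitImage ballImage thetaDiv n lat sig split qData t tq ρ qK htq0 htq1 hpin h6]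
  norm_num

end Summit.ABC.IUTFork.Joshi

end
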